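import Summits.Parity.GeneralizedHardyLittlewood.Theses.ZDegreeToeplitzBand
import Literature.NumberTheory.LFunctions.Zhang2022.KnifeEdgeLenZDegreePsiOn

/-!
# Route `ZDegreeToeplitzBand` — GLUE item stmt-Parity-20431 `PsiGradedTablesCloseOfShort`:
# K2 (`PsiGradedTablesClose`) from its half-class children `ShortPairsTauTwoDark` and `ShortPairsSchurClose`

The planner's glue proof (`psiGradedTablesClose_of_split`, HOME/knife/len/route-ZDegreeToeplitzBand/classcall/Sketch.lean
sha16 796308d61ff6dd96, tenure planner ls-knife-plan g0, CLASS-CALL v1.2) landed verbatim: on the (A)-recurrent horn take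
`c′ ≥ max(c₁,c₂)`; restrict the full degree-1 tables to `ShortPairs`; `X₂ f f′ g₂ g₂′ = 0` on the triple's short pair by
`KnifeEdge.eq_zero_of_tauTwoDarkShort`; the Schur horn `KnifeEdge.gradedQuadForm_dark_schur_neg` with amplitudes
`(−X₁/𝔅f, 1, −conj Y₁/𝔅g₂)` gives the negative graded form. No K0. **Not a claim about Theorems 1–2 of arXiv:2211.02515
or about Landau–Siegel zeros; the programme SEARCHES and TYPES.** [cite: Zhang2022LandauSiegel, §2 (2.16)–(2.17), §8 (8.5)]

Prover: ls-knife-typer-1 g8 (cell landau-siegel §D, K1″a hand).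
-/

namespace Summit.Parity.GeneralizedHardyLittlewood.Theorems

open Literature.NumberTheory.LFunctions.Zhang2022
open Literature.NumberTheory.LFunctions.Zhang2022.KnifeEdge
open Literature.NumberTheory.LFunctions.Zhang2022.Skeleton
open Summit.Parity.GeneralizedHardyLittlewood.Theses.ZDegreeToeplitzBand

/-- **GLUE (stmt-Parity-20431): `ShortPairsTauTwoDark → ShortPairsSchurClose → PsiGradedTablesClose`.** On the
(A)-recurrent horn: short tables from the full ones (`CrossTablePsi.on`, `DualCrossTablePsi.on`), `X₂ = 0` on the witness
triple's short pair (`eq_zero_of_tauTwoDarkShort`), then `gradedMainMatrix_congr` + `gradedQuadForm_dark_schur_neg`.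
The planner's proof, verbatim. [cite: Zhang2022LandauSiegel, §2 (2.16)–(2.17), §8 (8.5)] -/
theorem psiGradedTablesCloseOfShort_proof :
    Summit.Parity.GeneralizedHardyLittlewood.Theses.ZDegreeToeplitzBand.PsiGradedTablesCloseOfShort := by
  intro hd hs hA
  obtain ⟨c₁, hd⟩ := hd
  obtain ⟨c₂, hs⟩ := hs hA
  refine ⟨max c₁ c₂, fun c' hc' X₁ Y₁ X₂ t1 t21 t2 => ?_⟩
  obtain ⟨f, f', g₁, g₁', g₂, g₂', hf, hg₁, hg₂, c01, c02, c12, hB0, hB2, hlt⟩ :=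
    hs c' (le_trans (le_max_right _ _) hc') X₁ Y₁ (t1.on _) (t21.on _)
  have hX₂ : X₂ f f' g₂ g₂' = (0 : PairFunctional) f f' g₂ g₂' :=
    eq_zero_of_tauTwoDarkShort t2 (hd c' (le_trans (le_max_left _ _) hc')) hA hf hg₂ c02
  have key := gradedQuadForm_dark_schur_neg (X₁ := X₁) (Y₁ := Y₁) hB0 hB2 hlt
  rw [← gradedMainMatrix_congr (X₁ := X₁) (Y₁ := Y₁) rfl rfl hX₂] at key
  exact ⟨f, f', g₁, g₁', g₂, g₂', _, hf, hg₁, hg₂, key⟩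

end Summit.Parity.GeneralizedHardyLittlewood.Theorems
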